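import Literature.NumberTheory.LFunctions.ZetaLogDerivRealBound
import Literature.NumberTheory.LFunctions.Zhang2022.Section4Lemma45
import Literature.NumberTheory.LFunctions.XiHeatRayGaussian
import HarnessLib

/-!
# `ζ(s)/ζ(s₀)` on short segments right of the `1`-line (window amplitude of the BAND line)

RH ladder column JENSEN, rung J-P(P3) «log band», BAND crux `XiDerivBandRealAllRates` of route
«JensenLogBand», line «band-one-window» (u-arc reshape), lead rh-jensen-prover g7 — infrastructure
lemma (I2-window) of HOME/rh-jensen-prover/g7-work/LINE-PLAN.md. RH-FREE classical analysis
(Euler-product side only). WHAT THIS IS NOT: nothing here bears on zeros of `ζ` or the truth of RH.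

In Laplace's method for the right half-arc transform (`LogBandArc.laplace_window_core`,
`Theorems/JensenLogBandLaplaceCore.lean`) the factor `ζ(½ + u)` of the integrand is an AMPLITUDE
across the Gaussian window at abscissa `σ_w ≥ 1 + δ`: what is needed is
`‖ζ(s)/ζ(s₀) − 1‖ ≤ η` for `‖s − s₀‖ ≤ r`, with `η → 0` as the window shrinks. This file proves

  `‖ζ(s)/ζ(s₀) − 1‖ ≤ (‖s − s₀‖/δ) · e^{‖s − s₀‖/δ}`   for `Re s, Re s₀ ≥ 1 + δ`

(`LogBandArc.norm_riemannZeta_div_sub_one_le`): the segment `[s₀, s]` stays in `Re ≥ 1 + δ`,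
`ζ(s) = ζ(s₀) exp((s−s₀)∫₀¹ ζ′/ζ)` along it (tree
`Zhang2022.Lemma45.eq_mul_exp_integral_logDeriv_segment`), `‖ζ′/ζ‖ < 1/(σ − 1) ≤ 1/δ` there
(tree `norm_deriv_riemannZeta_div_lt`), and `‖e^Δ − 1‖ ≤ ‖Δ‖e^{‖Δ‖}`.
-/

noncomputable section

-- single-problem summit: `Summit.RiemannHypothesis.RiemannHypothesis.…` is the tree convention
set_option linter.dupNamespace false

open Complex Real MeasureTheory intervalIntegral Set
open scoped Interval

namespace Summit.RiemannHypothesis.RiemannHypothesis.Theorems.JensenPolynomials.LogBandArc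

open Literature.NumberTheory.LFunctions

/-- Points of the segment `s₀ + x(s − s₀)`, `x ∈ [0,1]`, between two points of the half-plane
`Re ≥ 1 + δ` lie in that half-plane. [folklore] -/
theorem re_segment_ge {s₀ s : ℂ} {δ : ℝ} (h₀ : 1 + δ ≤ s₀.re) (h₁ : 1 + δ ≤ s.re)
    {x : ℝ} (hx : x ∈ Icc (0 : ℝ) 1) : 1 + δ ≤ (s₀ + (x : ℂ) * (s - s₀)).re := by
  have hre : (s₀ + (x : ℂ) * (s - s₀)).re = (1 - x) * s₀.re + x * s.re := by
    simp [Complex.mul_re]; ring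
  rw [hre]
  nlinarith [hx.1, hx.2]

/-- **`ζ`-ratio on a short segment right of the `1`-line.** For `δ > 0` and `Re s₀, Re s ≥ 1 + δ`:
`‖ζ(s)/ζ(s₀) − 1‖ ≤ (‖s − s₀‖/δ) e^{‖s − s₀‖/δ}`. [folklore] -/
theorem norm_riemannZeta_div_sub_one_le {s₀ s : ℂ} {δ : ℝ} (hδ : 0 < δ) (h₀ : 1 + δ ≤ s₀.re)
    (h₁ : 1 + δ ≤ s.re) :
    ‖riemannZeta s / riemannZeta s₀ - 1‖ ≤ ‖s - s₀‖ / δ * Real.exp (‖s - s₀‖ / δ) := by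
  set w : ℂ := s - s₀ with hw
  have hseg : ∀ x ∈ Icc (0 : ℝ) 1, 1 + δ ≤ (s₀ + (x : ℂ) * w).re := fun x hx =>
    re_segment_ge h₀ h₁ hx
  have hne1 : ∀ x ∈ Icc (0 : ℝ) 1, s₀ + (x : ℂ) * w ≠ 1 := by
    intro x hx h
    have := hseg x hx
    rw [h, Complex.one_re] at this
    linarith
  have han : ∀ x ∈ Icc (0 : ℝ) 1, AnalyticAt ℂ riemannZeta (s₀ + (x : ℂ) * w) := by
    intro x hx
    refine DifferentiableOn.analyticAt (s := {z : ℂ | z ≠ 1}) ?_ (isOpen_ne.mem_nhds (hne1 x hx))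
    intro z hz
    exact (differentiableAt_riemannZeta hz).differentiableWithinAt
  have hz0 : ∀ x ∈ Icc (0 : ℝ) 1, riemannZeta (s₀ + (x : ℂ) * w) ≠ 0 := fun x hx =>
    riemannZeta_ne_zero_of_one_lt_re (by have := hseg x hx; linarith)
  have hζ₀ : riemannZeta s₀ ≠ 0 := riemannZeta_ne_zero_of_one_lt_re (by linarith)
  -- two-point control along the segment
  have hexp := Zhang2022.Lemma45.eq_mul_exp_integral_logDeriv_segment han hz0
  have hsw : s₀ + w = s := by rw [hw]; ring
  rw [hsw] at hexp
  set Δ : ℂ := w * ∫ x in (0 : ℝ)..1, deriv riemannZeta (s₀ + (x : ℂ) * w) /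
    riemannZeta (s₀ + (x : ℂ) * w) with hΔ
  have hratio : riemannZeta s / riemannZeta s₀ - 1 = cexp Δ - 1 := by
    rw [hexp]; field_simp
  -- the integrand is bounded by `1/δ`
  have hbound : ∀ x ∈ Ι (0 : ℝ) 1, ‖deriv riemannZeta (s₀ + (x : ℂ) * w) /
      riemannZeta (s₀ + (x : ℂ) * w)‖ ≤ 1 / δ := by
    intro x hx
    rw [uIoc_of_le zero_le_one] at hx
    have hx' : x ∈ Icc (0 : ℝ) 1 := ⟨hx.1.le, hx.2⟩
    have hσ := hseg x hx'
    have hlt := norm_deriv_riemannZeta_div_lt (s := s₀ + (x : ℂ) * w) (by linarith)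
    refine hlt.le.trans ?_
    exact one_div_le_one_div_of_le hδ (by linarith)
  have hΔle : ‖Δ‖ ≤ ‖s - s₀‖ / δ := by
    rw [hΔ, norm_mul]
    have hint := intervalIntegral.norm_integral_le_of_norm_le_const hbound
    rw [sub_zero, abs_one, mul_one] at hint
    calc ‖w‖ * ‖∫ x in (0 : ℝ)..1, deriv riemannZeta (s₀ + (x : ℂ) * w) /
          riemannZeta (s₀ + (x : ℂ) * w)‖ ≤ ‖w‖ * (1 / δ) :=
          mul_le_mul_of_nonneg_left hint (norm_nonneg _)
      _ = ‖s - s₀‖ / δ := by rw [hw]; ring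
  rw [hratio]
  calc ‖cexp Δ - 1‖ ≤ ‖Δ‖ * Real.exp ‖Δ‖ := norm_cexp_sub_one_le_mul_exp Δ
    _ ≤ ‖s - s₀‖ / δ * Real.exp (‖s - s₀‖ / δ) :=
        mul_le_mul hΔle (Real.exp_le_exp.2 hΔle) (Real.exp_pos _).le
          (div_nonneg (norm_nonneg _) hδ.le)

/-- The same bound with a radius: `‖s − s₀‖ ≤ r` ⇒ `‖ζ(s)/ζ(s₀) − 1‖ ≤ (r/δ) e^{r/δ}`. [folklore] -/
theorem norm_riemannZeta_div_sub_one_le_of_norm_le {s₀ s : ℂ} {δ r : ℝ} (hδ : 0 < δ)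
    (h₀ : 1 + δ ≤ s₀.re) (h₁ : 1 + δ ≤ s.re) (hr : ‖s - s₀‖ ≤ r) :
    ‖riemannZeta s / riemannZeta s₀ - 1‖ ≤ r / δ * Real.exp (r / δ) := by
  have h := norm_riemannZeta_div_sub_one_le hδ h₀ h₁
  have hle : ‖s - s₀‖ / δ ≤ r / δ := div_le_div_of_nonneg_right hr hδ.le
  refine h.trans ?_
  exact mul_le_mul hle (Real.exp_le_exp.2 hle) (Real.exp_pos _).le
    ((div_nonneg (norm_nonneg _) hδ.le).trans hle)

end Summit.RiemannHypothesis.RiemannHypothesis.Theorems.JensenPolynomials.LogBandArc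

end
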